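import Summits.QuantumFields.Balaban3D.Proofs.AxialFibre
import Summits.QuantumFields.YangMills.Theorems.BalabanUVNodesN08TrivialHistoryDominates

/-!
# BalabanUVNodes ∕ N08 — AXIAL DECIMATION FORGETS: the Radon–Nikodym transport along the axial (decimation) averaging of ANY integrable density that does not
# depend on the LAST bond of each line is the CONSTANT `∫ρ dU` (a.e.); hence at print's averaging [Balaban1985Averaging] (15) — axial off the small-field guard —
# such a density is transported to at most its MEAN plus the guarded part: the first kernel piece of the «no-stacking» mechanism behind the node's transport letter

Track A, DAG node N08 = T. Bałaban, CMP **102** (1985) 255–275 [Balaban1985UV3]: (2) p. 256 («ρ_{k+1} = Tρ_k»), (10) p. 258 («∫dU δ(ŪV^{−1}) …»), Thm 1 (5) p. 257 (bounds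
extensive in the CURRENT lattice `|T₁^{(k)}|` — no accumulation over scales); the averaging = [Balaban1985Averaging] (15) p. 19 with its axial factor `U(Γ_{c,x})`; the typed (0.4)
guard = [Balaban1987RG1] (0.4) p. 253.  Cell `pub-ymgap`, width seat `pub-ymgap-dag-n08-w1` (g6), W-SEAT-START-LIST §n08 item 1 successor piece (o26) = file 32; `--supports` K1⁹
`StabilityBRunRowsAtRecordR13SepCoPHV` (stmt-QuantumFields-27364, KEY MAP v2; helper).  Companion of files 28–31 (the EXACT transport residual = the floored Haar iterate `f_k`,
its comparison principle, (a)′∀, gauge invariance), of pub-balaban3d's `Proofs.AxialFibre` (p4: the fibre parametrisation `Φ(V,W)` of the axial average, `(Tρ)(V) = ∫ρ(Φ(V,W)) dW`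
a.e.) and of n08-w3 g4's guard split `…HaarCompatibilityGuardTransport.map_avOfPrint_le` (`μ∘Ū⁻¹ ≤ μ∘axial⁻¹ + (μ↾G)∘Ū⁻¹`).

THE POINT (located, count-neutral).  Files 25∕28∕30 reduced N08's transport input to a `k`-UNIFORM sup-bound on the floored iterate `f_{k+1} = max(1, T_k f_k)` of Haar under (15);
the naive estimate `sup T_k f_k ≤ sup f_k · sup T_k 1` STACKS the one-step constants over scales (n08-w3 g4 `N08-EML-JACOBIAN.md` §4).  What prevents stacking must be that `T_k`
FORGETS.  This file proves the exact forgetting of the decimation part: the fibre parametrisation `Φ(V, W)` of the axial average modifies `W` ONLY on the last bond of each line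
(`AxialFibre.axialParam`), so for a density `ρ` with `ρ(Φ(V,W)) = ρ(W)` (⟺ `ρ` does not depend on the last bonds) the fibre integral `∫ρ(Φ(V,W)) dW = ∫ρ dW` is independent of
`V`: **`T^{axial}ρ = ∫ρ dU` a.e.** (§1) and `(ρ·dU)∘axial⁻¹ = (∫ρ)·dV` (§1, measure form).  At print's averaging `avOfPrint N S j` (= axial wherever no coarse bond is guarded) this
gives (§2) **`(ρ·dU_j)∘Ū_j⁻¹ ≤ (∫ρ dU_j)·dU_{j+1} + ((ρ·dU_j)↾G_j)∘Ū_j⁻¹`** — the transported density of a last-bond-invariant `ρ ≥ 0` is at most its MEAN plus the transported GUARDED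
part: the sup of `ρ` does NOT propagate; only the (rare) guard events create new density.  §3 displays the consequence for one step of the floored iterate: if the input `f` of a step
is (a.e.) last-bond-invariant, then `max(1, T_j f)·dU_{j+1} ≤ dU_{j+1} + ((∫f − 1)·dU_{j+1} + ((f·dU_j)↾G_j)∘Ū_j⁻¹)` — «NEW EXCESS ≤ OLD EXCESS MASS (a constant, tiny: file 28's
`lintegral_massRecAC_triv_le`) + FRESH GUARD DEFECTS», no product of sups.  Whether the actual iterates `f_k` are (close to) last-bond-invariant — i.e. whether the guard defects
created at level `k` avoid the last bonds of the level-`k` lines, or the same argument run with another bond per line — is the cluster-geometry question of road (ii); nothing here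
decides it.

WHAT THIS FILE PROVES (kernel; theorems only, 0 def; [folklore] measure theory over `AxialFibre`; nothing of the papers asserted).
* §1 (any `G` with the carrier's measurability instances, standing range `j + 1 ≤ m + K`) ★★★ `rnTransport_axial_ae_eq_integral_of_lastInvariant` — `ρ` integrable,
  `ρ(Φ(V,W)) = ρ(W)` ⇒ `T^{axial}ρ = ∫ρ dU` `dV`-a.e.; ★★ `map_axialAvg_withDensity_of_lastInvariant` — `(ρ·dU)∘axial⁻¹ = (∫ρ)·dV` (`ρ ≥ 0`); `lastInvariant_const`,
  `lastInvariant_of_forall_lastExt` (sufficient condition: invariance under right multiplication of the last bonds — the form in which locality is checked), `lastInvariant_mul`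
  ∕ `lastInvariant_max` (closure properties).
* §2 (print's averaging on `SU(N)`, every `N`, `j + 1 ≤ K`) ★★★ `map_avOfPrint_withDensity_le_of_lastInvariant` — **forgetting + fresh defects**: `(ρ·dU_j)∘Ū_j⁻¹ ≤ (∫ρ)·dU_{j+1} +
  ((ρ·dU_j)↾G_j)∘Ū_j⁻¹`; `rnTransport_avOfPrint_le_integral_add_ae_of_lastInvariant` — a.e. density form `T_j ρ ≤ ∫ρ + d[((ρ·dU_j)↾G_j)∘Ū_j⁻¹]∕dU_{j+1}`.
* §3 ★★ `floorStep_le_of_lastInvariant` — the one-step floored recursion with a last-bond-invariant input: `max(1, T_j f)·dU_{j+1} ≤ (∫f dU_j)·dU_{j+1} + ((f·dU_j)↾G_j)∘Ū_j⁻¹`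
  (`f ≥ 1`); inhabited at `f ≡ 1` (`floorStep_one_le`: the first floored iterate `f_1·dU_1 ≤ dU_1 + (dU_0↾G_0)∘Ū_0⁻¹` — n08-w3's guard family's first member, recovered).

HONEST FRAMING: count-neutral helper; no density bound on the guarded parts and no statement about the actual iterates `f_k`, `k ≥ 2`, is claimed — (a)′ ∕ (F) ∕ E6′ NOT decided;
`PrintedUV3V` NOT proved; N08 NOT discharged; one finite 𝕋⁴ programme at fixed ε, Bałaban AS PRINTED — R4 closes the conditional finite-𝕋⁴ rung `BalabanLadder.UV` only; the
Yang–Mills mass gap (Clay) is NOT proved by any of this; nothing continuum ∕ ℝ⁴ ∕ OS.  No `sorry`, standard axioms.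
-/

noncomputable section

open MeasureTheory
open scoped ENNReal

namespace Summit.QuantumFields.YangMills.BalabanUVNodes.N08AxialDecimationForgets

open Literature.MathematicalPhysics.QuantumFieldTheory.Balaban1983to89
open Literature.MathematicalPhysics.QuantumFieldTheory.Balaban1983to89.AveragingRT
  (rnTransport pushDensity rnTransport_nonneg axialAvg measurable_axialAvg map_axialAvg line)
open Summit.QuantumFields.Balaban3D.Carriers
open Summit.QuantumFields.Balaban3D.Proofs.AxialFibre (axialParam lastExt rnTransport_axial_ae_eq lastExt_last lastExt_of_not_last)
open Summit.QuantumFields.YangMills.BalabanUVNodes.N08TrivialHistoryIteratedTransport (withDensity_rnTransport_eq_pushDensity)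

/-! ## §1 Axial decimation forgets every density that ignores the last bonds -/
section Axial

variable {P : Params} {j : ℕ} {G : Type} [GaugeGroup G] [MeasurableSpace G] [HaarData G] [MeasurableMul₂ G] [MeasurableInv G]

/-- ★★★ **AXIAL DECIMATION FORGETS**: if an integrable density `ρ` on the level-`j` fields is invariant under the fibre parametrisation of the axial average, `ρ(Φ(V, W)) = ρ(W)`
(`Φ = AxialFibre.axialParam` modifies `W` only on the LAST bond of each line — so this says `ρ` does not depend on those bonds), then its Radon–Nikodym transport along the
axial average is the CONSTANT `∫ρ dU`, `dV`-almost everywhere (standing range): the fibre integral `∫ρ(Φ(V,W)) dW` (`AxialFibre.rnTransport_axial_ae_eq`) does not see `V`.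
[cite: Balaban1985UV3, (10) p.258 + (2) p.256 (bookkeeping); Balaban1985Averaging, (15) p.19 (the axial factor)] -/
theorem rnTransport_axial_ae_eq_integral_of_lastInvariant (hj : j + 1 ≤ P.m + P.K) (ρ : Density P j G) (hρ : Integrable ρ (fieldMeasure P j G))
    (hinv : ∀ (V : GaugeField P (j + 1) G) (W : GaugeField P j G), ρ (axialParam V W) = ρ W) :
    rnTransport (axialAvg : GaugeField P j G → GaugeField P (j + 1) G) ρ =ᵐ[fieldMeasure P (j + 1) G]
      fun _ => ∫ W, ρ W ∂(fieldMeasure P j G) := by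
  filter_upwards [rnTransport_axial_ae_eq hj ρ hρ] with V hV
  rw [hV]
  exact integral_congr_ae (Filter.Eventually.of_forall fun W => hinv V W)

/-- ★★ **MEASURE FORM: `(ρ·dU)∘axial⁻¹ = (∫ρ dU)·dV`** for a non-negative integrable last-bond-invariant density (`AvgAC` of the axial average from `map_axialAvg`; file 25's
`withDensity_rnTransport_eq_pushDensity`; §1). [cite: Balaban1985UV3, (10) p.258 (bookkeeping); Balaban1985Averaging, (15) p.19] -/
theorem map_axialAvg_withDensity_of_lastInvariant (hj : j + 1 ≤ P.m + P.K) (ρ : Density P j G) (hρ0 : ∀ W, 0 ≤ ρ W) (hρ : Integrable ρ (fieldMeasure P j G))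
    (hinv : ∀ (V : GaugeField P (j + 1) G) (W : GaugeField P j G), ρ (axialParam V W) = ρ W) :
    ((fieldMeasure P j G).withDensity fun W => ENNReal.ofReal (ρ W)).map (axialAvg : GaugeField P j G → GaugeField P (j + 1) G) =
      ENNReal.ofReal (∫ W, ρ W ∂(fieldMeasure P j G)) • fieldMeasure P (j + 1) G := by
  have hac : AvgAC (axialAvg : GaugeField P j G → GaugeField P (j + 1) G) := AvgAC.of_map_eq measurable_axialAvg (map_axialAvg hj)
  have h1 : ((fieldMeasure P j G).withDensity fun W => ENNReal.ofReal (ρ W)).map (axialAvg : GaugeField P j G → GaugeField P (j + 1) G) =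
      pushDensity (axialAvg : GaugeField P j G → GaugeField P (j + 1) G) ρ := rfl
  rw [h1, ← withDensity_rnTransport_eq_pushDensity hac hρ0 hρ, ← withDensity_const]
  refine withDensity_congr_ae ?_
  filter_upwards [rnTransport_axial_ae_eq_integral_of_lastInvariant hj ρ hρ hinv] with V hV
  rw [hV]

omit [MeasurableSpace G] [HaarData G] [MeasurableMul₂ G] [MeasurableInv G] in
/-- Constants are last-bond-invariant. [folklore] -/
theorem lastInvariant_const (a : ℝ) : ∀ (V : GaugeField P (j + 1) G) (W : GaugeField P j G), (fun _ : GaugeField P j G => a) (axialParam V W) = (fun _ => a) W :=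
  fun _ _ => rfl

omit [MeasurableSpace G] [HaarData G] [MeasurableMul₂ G] [MeasurableInv G] in
/-- **A SUFFICIENT CONDITION in the form locality is checked**: if `ρ` is invariant under RIGHT MULTIPLICATION OF THE LAST BONDS by arbitrary coarse-bond-indexed group elements,
`ρ(W · lastExt g) = ρ(W)` for all `g`, then `ρ` is invariant under the fibre parametrisation (`Φ(V,W) = W · lastExt(…)` by definition). [folklore] -/
theorem lastInvariant_of_forall_lastExt {ρ : Density P j G} (h : ∀ (g : PBond P (j + 1) → G) (W : GaugeField P j G), ρ (fun b => W b * lastExt g b) = ρ W) :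
    ∀ (V : GaugeField P (j + 1) G) (W : GaugeField P j G), ρ (axialParam V W) = ρ W :=
  fun V W => h (fun c => (axialAvg W c)⁻¹ * V c) W

omit [MeasurableSpace G] [HaarData G] [MeasurableMul₂ G] [MeasurableInv G] in
/-- **… and the locality form**: if `ρ` depends on `W` only through the bonds that are NOT the last bond of any line (`ρ W = ρ W′` whenever `W`, `W′` agree off the last bonds), then
`ρ` is last-bond-invariant (`lastExt g = 1` off the last bonds). [folklore] -/
theorem lastInvariant_of_local {ρ : Density P j G}
    (h : ∀ W W' : GaugeField P j G, (∀ b, (¬ ∃ c : PBond P (j + 1), line c (P.L - 1) = b) → W b = W' b) → ρ W = ρ W') :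
    ∀ (V : GaugeField P (j + 1) G) (W : GaugeField P j G), ρ (axialParam V W) = ρ W := by
  refine lastInvariant_of_forall_lastExt fun g W => h _ _ fun b hb => ?_
  show W b * lastExt g b = W b
  rw [lastExt_of_not_last g hb, mul_one]

omit [MeasurableSpace G] [HaarData G] [MeasurableMul₂ G] [MeasurableInv G] in
/-- Products of last-bond-invariant densities are last-bond-invariant. [folklore] -/
theorem lastInvariant_mul {ρ σ : Density P j G} (hρ : ∀ (V : GaugeField P (j + 1) G) W, ρ (axialParam V W) = ρ W)
    (hσ : ∀ (V : GaugeField P (j + 1) G) W, σ (axialParam V W) = σ W) :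
    ∀ (V : GaugeField P (j + 1) G) (W : GaugeField P j G), (fun W => ρ W * σ W) (axialParam V W) = (fun W => ρ W * σ W) W :=
  fun V W => by simp only [hρ V W, hσ V W]

omit [MeasurableSpace G] [HaarData G] [MeasurableMul₂ G] [MeasurableInv G] in
/-- `max 1 ρ` of a last-bond-invariant density is last-bond-invariant (the floor of the (47)-term preserves the class). [folklore] -/
theorem lastInvariant_max {ρ : Density P j G} (hρ : ∀ (V : GaugeField P (j + 1) G) W, ρ (axialParam V W) = ρ W) :
    ∀ (V : GaugeField P (j + 1) G) (W : GaugeField P j G), (fun W => max 1 (ρ W)) (axialParam V W) = (fun W => max 1 (ρ W)) W :=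
  fun V W => by simp only [hρ V W]

end Axial

/-! ## §2 At print's averaging: forgetting + fresh defects -/
section Print

open Literature.MathematicalPhysics.QuantumFieldTheory.Balaban1985CMP102.Setting (Scales)
open Literature.MathematicalPhysics.QuantumFieldTheory.Balaban1983to89.B10RunsOfRecord (avOfPrint)
open Literature.MathematicalPhysics.QuantumFieldTheory.Balaban1983to89.ExpMeanLog (expMeanLogSU)
open Literature.MathematicalPhysics.QuantumFieldTheory.Balaban1983to89.BlockAveraging (Small)
open Literature.MathematicalPhysics.QuantumFieldTheory.Balaban1983to89.Node00 (SU)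
open Summit.QuantumFields.YangMills.BalabanUVNodes.N08HaarCompatibilityGuardTransport (map_avOfPrint_le)
open Summit.QuantumFields.YangMills.BalabanUVNodes.N08Thm2AtRecordBridgeInhabited (avgAC_avOfPrint)
open Summit.QuantumFields.YangMills.BalabanUVNodes.N08MassesACDominated (rnDeriv_le_of_le_withDensity)

variable (N : ℕ) [NeZero N] {L : ℕ} (S : Scales L) {j : ℕ}

/-- ★★★ **FORGETTING + FRESH DEFECTS AT PRINT'S AVERAGING**: for [Balaban1985Averaging] (15) on `SU(N)` (`Ū_j = avOfPrint N S j`, axial wherever no coarse bond is guarded — n08-w3's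
split `map_avOfPrint_le`) and every non-negative integrable density `ρ` on the level-`j` fields that does not depend on the last bonds of the lines (`ρ(Φ(V,W)) = ρ(W)`),
**`(ρ·dU_j)∘Ū_j⁻¹ ≤ (∫ρ dU_j)·dU_{j+1} + ((ρ·dU_j)↾G_j)∘Ū_j⁻¹`**, `G_j = {U | ∃ c, Small expMeanLogSU U c}` (`j + 1 ≤ K`): the transported measure is at most the MEAN of `ρ` times Haar
plus the transported GUARDED part — the sup of `ρ` does not propagate through the step. [cite: Balaban1985Averaging, (15) p.19; Balaban1987RG1, (0.4) p.253; Balaban1985UV3, (2) p.256] -/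
theorem map_avOfPrint_withDensity_le_of_lastInvariant (hj : j + 1 ≤ S.K) (ρ : Density S.P j (SU N)) (hρ0 : ∀ W, 0 ≤ ρ W)
    (hρ : Integrable ρ (fieldMeasure S.P j (SU N)))
    (hinv : ∀ (V : GaugeField S.P (j + 1) (SU N)) (W : GaugeField S.P j (SU N)), ρ (axialParam V W) = ρ W) :
    ((fieldMeasure S.P j (SU N)).withDensity fun W => ENNReal.ofReal (ρ W)).map (avOfPrint N S j).avg ≤
      ENNReal.ofReal (∫ W, ρ W ∂(fieldMeasure S.P j (SU N))) • fieldMeasure S.P (j + 1) (SU N) +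
        (((fieldMeasure S.P j (SU N)).withDensity fun W => ENNReal.ofReal (ρ W)).restrict
            {U : GaugeField S.P j (SU N) | ∃ c : PBond S.P (j + 1), Small (expMeanLogSU : LoopAverage (SU N)) U c}).map (avOfPrint N S j).avg := by
  have hjr : j + 1 ≤ S.P.m + S.P.K := by show j + 1 ≤ S.m + S.K; omega
  have h := map_avOfPrint_le N S hjr ((fieldMeasure S.P j (SU N)).withDensity fun W => ENNReal.ofReal (ρ W))
  rwa [map_axialAvg_withDensity_of_lastInvariant hjr ρ hρ0 hρ hinv] at h

/-- ★★ **… IN DENSITY CURRENCY**: `T_j ρ ≤ ∫ρ dU_j + B` `dU_{j+1}`-a.e. whenever the transported guarded part satisfies `((ρ·dU_j)↾G_j)∘Ū_j⁻¹ ≤ B·dU_{j+1}` — for a last-bond-invariant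
`ρ ≥ 0`, any measurable `B` (file 25's exact transport + §2 + file 16's comparison lemma). [cite: Balaban1985Averaging, (15) p.19; Balaban1987RG1, (0.4) p.253; Balaban1985UV3, (2) p.256] -/
theorem rnTransport_avOfPrint_le_integral_add_ae_of_lastInvariant (hj : j + 1 ≤ S.K) (ρ : Density S.P j (SU N)) (hρ0 : ∀ W, 0 ≤ ρ W)
    (hρ : Integrable ρ (fieldMeasure S.P j (SU N)))
    (hinv : ∀ (V : GaugeField S.P (j + 1) (SU N)) (W : GaugeField S.P j (SU N)), ρ (axialParam V W) = ρ W)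
    (B : GaugeField S.P (j + 1) (SU N) → ℝ≥0∞)
    (hB : (((fieldMeasure S.P j (SU N)).withDensity fun W => ENNReal.ofReal (ρ W)).restrict
            {U : GaugeField S.P j (SU N) | ∃ c : PBond S.P (j + 1), Small (expMeanLogSU : LoopAverage (SU N)) U c}).map (avOfPrint N S j).avg ≤
          (fieldMeasure S.P (j + 1) (SU N)).withDensity B) :
    ∀ᵐ V ∂(fieldMeasure S.P (j + 1) (SU N)),
      ENNReal.ofReal (rnTransport (avOfPrint N S j).avg ρ V) ≤ ENNReal.ofReal (∫ W, ρ W ∂(fieldMeasure S.P j (SU N))) + B V := by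
  have hmeasT : Measurable fun V => ENNReal.ofReal (rnTransport (avOfPrint N S j).avg ρ V) := (measurable_rnTransport _ _).ennreal_ofReal
  have hle : (fieldMeasure S.P (j + 1) (SU N)).withDensity (fun V => ENNReal.ofReal (rnTransport (avOfPrint N S j).avg ρ V)) ≤
      (fieldMeasure S.P (j + 1) (SU N)).withDensity ((fun _ => ENNReal.ofReal (∫ W, ρ W ∂(fieldMeasure S.P j (SU N)))) + B) := by
    rw [withDensity_rnTransport_eq_pushDensity (avgAC_avOfPrint N L S j) hρ0 hρ, withDensity_add_left measurable_const, withDensity_const]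
    exact (map_avOfPrint_withDensity_le_of_lastInvariant N S hj ρ hρ0 hρ hinv).trans (add_le_add le_rfl hB)
  have h1 := rnDeriv_le_of_le_withDensity hle
  have h2 := Measure.rnDeriv_withDensity (fieldMeasure S.P (j + 1) (SU N)) hmeasT
  filter_upwards [h1, h2] with V hV1 hV2
  rw [← hV2]
  exact hV1

/-! ## §3 One step of the floored recursion with a last-bond-invariant input: new excess ≤ old excess MASS + fresh guard defects -/

/-- ★★ **ONE FLOORED STEP WITHOUT STACKING**: if `f ≥ 1` is integrable and last-bond-invariant, then `max(1, T_j f)·dU_{j+1} ≤ (∫f dU_j)·dU_{j+1} + ((f·dU_j)↾G_j)∘Ū_j⁻¹` at print's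
averaging (`j + 1 ≤ K`) — since `∫f ≥ 1` the floor costs nothing, and the SUP of `f` never enters: only its MEAN and the guarded part.  (For the actual iterate `f_k` of files 28–30 the
hypothesis «last-bond-invariant» is the open cluster-geometry question; at `k = 0`, `f_0 ≡ 1`, it holds — `floorStep_one_le`.) [cite: Balaban1985UV3, (41) p.266 + (47) p.267 + (2) p.256; Balaban1985Averaging, (15) p.19; Balaban1987RG1, (0.4) p.253] -/
theorem floorStep_le_of_lastInvariant (hj : j + 1 ≤ S.K) (f : Density S.P j (SU N)) (hf1 : ∀ W, 1 ≤ f W) (hf : Integrable f (fieldMeasure S.P j (SU N)))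
    (hinv : ∀ (V : GaugeField S.P (j + 1) (SU N)) (W : GaugeField S.P j (SU N)), f (axialParam V W) = f W) :
    (fieldMeasure S.P (j + 1) (SU N)).withDensity (fun V => ENNReal.ofReal (max 1 (rnTransport (avOfPrint N S j).avg f V))) ≤
      ENNReal.ofReal (∫ W, f W ∂(fieldMeasure S.P j (SU N))) • fieldMeasure S.P (j + 1) (SU N) +
        (((fieldMeasure S.P j (SU N)).withDensity fun W => ENNReal.ofReal (f W)).restrict
            {U : GaugeField S.P j (SU N) | ∃ c : PBond S.P (j + 1), Small (expMeanLogSU : LoopAverage (SU N)) U c}).map (avOfPrint N S j).avg := by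
  have hf0 : ∀ W, 0 ≤ f W := fun W => zero_le_one.trans (hf1 W)
  -- the mean is at least `1`
  have hmean : (1 : ℝ) ≤ ∫ W, f W ∂(fieldMeasure S.P j (SU N)) := by
    have := integral_mono (integrable_const (1 : ℝ)) hf (fun W => hf1 W)
    simpa using this
  -- `max 1 (T f) = 1 ⊔ T f`: both pieces are dominated by the right-hand side
  have hT : (fieldMeasure S.P (j + 1) (SU N)).withDensity (fun V => ENNReal.ofReal (rnTransport (avOfPrint N S j).avg f V)) ≤
      ENNReal.ofReal (∫ W, f W ∂(fieldMeasure S.P j (SU N))) • fieldMeasure S.P (j + 1) (SU N) +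
        (((fieldMeasure S.P j (SU N)).withDensity fun W => ENNReal.ofReal (f W)).restrict
            {U : GaugeField S.P j (SU N) | ∃ c : PBond S.P (j + 1), Small (expMeanLogSU : LoopAverage (SU N)) U c}).map (avOfPrint N S j).avg := by
    rw [withDensity_rnTransport_eq_pushDensity (avgAC_avOfPrint N L S j) hf0 hf]
    exact map_avOfPrint_withDensity_le_of_lastInvariant N S hj f hf0 hf hinv
  have hone : (fieldMeasure S.P (j + 1) (SU N)).withDensity (fun _ => (1 : ℝ≥0∞)) ≤
      ENNReal.ofReal (∫ W, f W ∂(fieldMeasure S.P j (SU N))) • fieldMeasure S.P (j + 1) (SU N) +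
        (((fieldMeasure S.P j (SU N)).withDensity fun W => ENNReal.ofReal (f W)).restrict
            {U : GaugeField S.P j (SU N) | ∃ c : PBond S.P (j + 1), Small (expMeanLogSU : LoopAverage (SU N)) U c}).map (avOfPrint N S j).avg := by
    rw [withDensity_const, one_smul]
    refine le_trans ?_ (Measure.le_add_right le_rfl)
    have hc : (1 : ℝ≥0∞) ≤ ENNReal.ofReal (∫ W, f W ∂(fieldMeasure S.P j (SU N))) := by
      rw [← ENNReal.ofReal_one]; exact ENNReal.ofReal_le_ofReal hmean
    refine Measure.le_iff'.2 fun s => ?_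
    rw [Measure.smul_apply, smul_eq_mul]
    calc fieldMeasure S.P (j + 1) (SU N) s = 1 * fieldMeasure S.P (j + 1) (SU N) s := (one_mul _).symm
      _ ≤ ENNReal.ofReal (∫ W, f W ∂(fieldMeasure S.P j (SU N))) * fieldMeasure S.P (j + 1) (SU N) s := mul_le_mul_left hc _
  have heq : (fun V => ENNReal.ofReal (max 1 (rnTransport (avOfPrint N S j).avg f V))) =
      fun V => max ((fun _ => (1 : ℝ≥0∞)) V) (ENNReal.ofReal (rnTransport (avOfPrint N S j).avg f V)) := by
    funext V; rw [ENNReal.ofReal_max, ENNReal.ofReal_one]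
  rw [heq]
  exact N08MassesACLeastClosedFamily.withDensity_sup_le measurable_const (measurable_rnTransport _ _).ennreal_ofReal hone hT

/-- ★ **INHABITED INSTANCE (`f ≡ 1`): the first floored iterate obeys `f_1·dU_1 ≤ dU_1 + (dU_0↾G_0)∘Ū_0⁻¹`** — n08-w3's guard family's first member (file 17b) recovered from §3.
[cite: Balaban1985UV3, (47) p.267 + (2) p.256; Balaban1987RG1, (0.4) p.253] -/
theorem floorStep_one_le (hK : 1 ≤ S.K) :
    (fieldMeasure S.P 1 (SU N)).withDensity (fun V => ENNReal.ofReal (max 1 (rnTransport (avOfPrint N S 0).avg (fun _ => (1 : ℝ)) V))) ≤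
      fieldMeasure S.P 1 (SU N) +
        ((fieldMeasure S.P 0 (SU N)).restrict
            {U : GaugeField S.P 0 (SU N) | ∃ c : PBond S.P 1, Small (expMeanLogSU : LoopAverage (SU N)) U c}).map (avOfPrint N S 0).avg := by
  have h := floorStep_le_of_lastInvariant N S (j := 0) hK (fun _ => (1 : ℝ)) (fun _ => le_rfl) (integrable_const _) (fun _ _ => rfl)
  have hI : ENNReal.ofReal (∫ _W, (1 : ℝ) ∂(fieldMeasure S.P 0 (SU N))) = 1 := by
    rw [integral_const, smul_eq_mul, mul_one, probReal_univ, ENNReal.ofReal_one]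
  have hD : ((fieldMeasure S.P 0 (SU N)).withDensity fun _ : GaugeField S.P 0 (SU N) => ENNReal.ofReal (1 : ℝ)) = fieldMeasure S.P 0 (SU N) := by
    rw [ENNReal.ofReal_one, withDensity_const, one_smul]
  rw [hI, one_smul, hD] at h
  exact h

end Print

end Summit.QuantumFields.YangMills.BalabanUVNodes.N08AxialDecimationForgets

end
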